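import Literature.NumberTheory.DiophantineGeometry.SiegelTheoremIntegralPointsRat
import Summits.Schanuel.Schanuel.Theorems.RootDecomp1KLevelFinite02

/-!
# RootDecomp1KSiegelBridge — the consumer-side bridge from LANG's printed form of SIEGEL's theorem to the K-line
binder `SiegelShapes` — part 1 (RootDecomp1KSiegelBridge01): models and shapes

Census-1 gen 22, ×0 INFRASTRUCTURE on the (γ) lane of RULE K-R40 (viii) (critic GO L2539, CLAUSE MAP
census/tools/gen22/bridge/CLAUSEMAP.md ACK L2541; no lens credit, no census credit).  The cite item wi-102309 filed with
lens-1 g51 node 10 is DONE: the Literature module `SiegelTheoremIntegralPoints` (p841349) carries the NAMED FACT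
`Literature.NumberTheory.DiophantineGeometry.Lang1983_integralValues_planeCurve_parametric` (Lang 1983 Ch. 8 Thm 2.4 +
Thm 5.1 + p. 165, typed for the plane model), and `SiegelTheoremIntegralPointsRat` (p842044) its `K = ℚ` dictionary
(`ℚ` finitely generated over its prime field, `ℤ[1/2] = Subring.closure {2⁻¹}` = the dyadic rationals, Gauss's lemma
for a prime `P ∈ ℤ[x][Y]`, the dyadic instance `Lang1983_integralValues_planeCurve_parametric.of_prime_int_dyadic`).
This chain proves `siegelShapes_of_lang1983 : Lang1983_integralValues_planeCurve_parametric → SiegelShapes` (part 2),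
so that the K-line's uniform results (`thinFibre_of_siegelShapes''` …, `RootDecomp1KLevelFinite09` §8.8) hang on a
verbatim-print Literature fact instead of the HOME-typed binder (part 3).  The bridge consumes only the WEAKER fragment
(iii) two-pole shape + (iv) finite exceptional set / parametrisation of all rational points + (v) degree clause of the
printed theorem.

This part.  MODELS (§1–§2): the tree's real evaluation `bev P x r` at rational `x, r` against Mathlib's `evalEval` on
the `ℚ`-model `P.map (mapRingHom (Int.castRingHom ℚ))` (through the Literature dictionary `evalEval_map_intCast`);
the negation of `SiegelShapes`' clause (A) in the currency of the dyadic instance of the fact; integer scaling of a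
rational polynomial.  SHAPES (§3–§7): the elementary steps that turn LANG's two printed pole shapes of `x = P(t) ∈ ℚ(t)`
(`LangTwoPoleShape P`: `x = g(t)/tᵐ` or `x = g(t)/q(t)ᵐ`, `q` an irreducible quadratic) into the three INTEGRAL shapes
of `SiegelShapes` (polynomial `f(t)/D`, Laurent `g(t)/(D·tᵃ)` with `g(0) ≠ 0`, `1 ≤ a < deg g`, norm `g(t)/(D·q(t)ᵃ)`
with `NormShapeHyp`): cross-multiplication at a parameter; the degree clause for a polynomial and for a quotient;
cancelling the common power of an irreducible factor and re-normalising in `ℚ(t)`; the flip `t ↦ 1/t` (via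
`Polynomial.reflect`); an irreducible quadratic has no rational root, coprime polynomials no common complex root.
Rung 0 — nothing here proves Schanuel, 33364 or 31077.
-/

noncomputable section

open Polynomial
open scoped Polynomial.Bivariate

namespace Summit.Schanuel.Schanuel.Theorems.RootDecomp1KSiegelBridge

open Summit.Schanuel.Schanuel.Theorems.RootDecomp1KDegreeLadder (bev)
open Summit.Schanuel.Schanuel.Theorems.RootDecomp1KLevelFinite (IsDyadic)
open Literature.NumberTheory.DiophantineGeometry (evalEval_map_intCast)

/-! ### §1  The `ℚ`-model of an integer plane curve and the evaluation conventions -/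

/-- the tree's real evaluation `bev P x y` (inner variable `↦ x`, outer `↦ y`) IS Mathlib's `evalEval` on the real
model (Literature dictionary `evalEval_map_intCast` at `K = ℝ`). -/
theorem bev_eq_evalEval_real (P : ℤ[X][X]) (x y : ℝ) :
    bev P x y = (P.map (mapRingHom (Int.castRingHom ℝ))).evalEval x y := by
  rw [evalEval_map_intCast]; rfl

/-- the evaluation convention agrees with the `ℚ`-model: for rational `x, r`,
`bev P x r = ((P.map (mapRingHom (Int.castRingHom ℚ))).evalEval x r : ℝ)`. -/
theorem bev_ratCast (P : ℤ[X][X]) (x r : ℚ) :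
    bev P (x : ℝ) (r : ℝ) = (((P.map (mapRingHom (Int.castRingHom ℚ))).evalEval x r : ℚ) : ℝ) := by
  rw [bev_eq_evalEval_real]
  have h := map_mapRingHom_evalEval (Rat.castHom ℝ) (P.map (mapRingHom (Int.castRingHom ℚ))) x r
  rw [Polynomial.map_map, mapRingHom_comp] at h
  have hc : (Rat.castHom ℝ).comp (Int.castRingHom ℚ) = Int.castRingHom ℝ := RingHom.ext_int _ _
  rw [hc] at h
  simpa using h

/-- `bev P x r = 0 ↔ (P.map (mapRingHom (Int.castRingHom ℚ))).evalEval x r = 0` for rational `x, r`. -/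
theorem bev_eq_zero_iff (P : ℤ[X][X]) (x r : ℚ) :
    bev P (x : ℝ) (r : ℝ) = 0 ↔ (P.map (mapRingHom (Int.castRingHom ℚ))).evalEval x r = 0 := by
  rw [bev_ratCast]; exact_mod_cast Iff.rfl

/-! ### §2  Clause (A) negated, in the currency of the dyadic instance of the fact; integer scaling -/

/-- if clause (A) of `SiegelShapes` FAILS (infinitely many dyadic `x` carry a rational point of `P`), the infinitude
hypothesis of `Lang1983_integralValues_planeCurve_parametric.of_prime_int_dyadic` holds. -/
theorem dyadic_points_infinite (P : ℤ[X][X]) (hA : ¬ Set.Finite {x : ℚ | IsDyadic x ∧ ∃ r : ℚ, bev P x r = 0}) :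
    {x : ℚ | (∃ k : ℕ, x.den = 2 ^ k) ∧ ∃ y : ℚ, (P.map (mapRingHom (Int.castRingHom ℚ))).evalEval x y = 0}.Infinite := by
  refine Set.Infinite.mono ?_ hA
  rintro x ⟨hx, r, hr⟩
  exact ⟨hx, r, (bev_eq_zero_iff P x r).mp hr⟩

/-- every `g ∈ ℚ[t]` is `G/b` with `G ∈ ℤ[t]`, `b ∈ ℤ ∖ {0}`: `G.map = C b * g`. -/
theorem exists_int_scaling (g : ℚ[X]) :
    ∃ (G : ℤ[X]) (b : ℤ), b ≠ 0 ∧ G.map (Int.castRingHom ℚ) = C (b : ℚ) * g := by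
  obtain ⟨b, hbM, hb⟩ := IsLocalization.integerNormalization_spec (nonZeroDivisors ℤ) g
  refine ⟨IsLocalization.integerNormalization (nonZeroDivisors ℤ) g, b, nonZeroDivisors.ne_zero hbM, ?_⟩
  rw [algebraMap_int_eq] at hb
  rw [hb, zsmul_eq_mul, ← C_eq_intCast]

/-- integer scaling preserves the degree. -/
theorem natDegree_of_int_scaling {g : ℚ[X]} {G : ℤ[X]} {b : ℤ} (hb : b ≠ 0)
    (hG : G.map (Int.castRingHom ℚ) = C (b : ℚ) * g) : G.natDegree = g.natDegree := by
  rw [← natDegree_map_eq_of_injective (Int.castRingHom ℚ).injective_int G, hG,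
    natDegree_C_mul (by exact_mod_cast hb)]

/-- integer scaling and evaluation: `aeval t G = b * aeval t g` for `t ∈ ℚ`. -/
theorem aeval_of_int_scaling {g : ℚ[X]} {G : ℤ[X]} {b : ℤ} (hG : G.map (Int.castRingHom ℚ) = C (b : ℚ) * g)
    (t : ℚ) : aeval t G = b * aeval t g := by
  have h1 : aeval t (G.map (algebraMap ℤ ℚ)) = aeval t G := aeval_map_algebraMap ℚ t G
  rw [algebraMap_int_eq, hG, map_mul, aeval_C] at h1
  simpa using h1.symm

/-! ### §3  Cross-multiplication at a parameter -/

/-- **CROSS-MULTIPLICATION.**  If `P = p/q` in `ℚ(t)` (`q ≠ 0`) and `x = P(t₀)` where the REDUCED denominator of `P`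
does not vanish at `t₀`, then `p(t₀) = x · q(t₀)` (also when `q(t₀) = 0`, in which case `p(t₀) = 0`). -/
theorem eval_eq_mul_of_repr {p q : ℚ[X]} (hq : q ≠ 0) {P : RatFunc ℚ}
    (hP : P = algebraMap ℚ[X] (RatFunc ℚ) p / algebraMap ℚ[X] (RatFunc ℚ) q) {t x : ℚ}
    (hden : P.denom.eval t ≠ 0) (hx : P.eval (RingHom.id ℚ) t = x) : p.eval t = x * q.eval t := by
  have hnd : P.num * q = p * P.denom := (RatFunc.num_mul_eq_mul_denom_iff hq).mpr hP
  have hev := congrArg (Polynomial.eval t) hnd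
  simp only [eval_mul] at hev
  have hx' : P.num.eval t = x * P.denom.eval t := by
    rw [← hx, RatFunc.eval, eval₂_id, eval₂_id, div_mul_cancel₀ _ hden]
  rw [hx'] at hev
  -- `x · denom(t) · q(t) = p(t) · denom(t)`
  have h3 : (x * q.eval t) * P.denom.eval t = p.eval t * P.denom.eval t := by rw [← hev]; ring
  exact (mul_right_cancel₀ hden h3).symm

/-! ### §4  The degree clause -/

/-- for a POLYNOMIAL `x = p(t)`: `max (deg num) (deg denom) = deg p`. -/
theorem degClause_algebraMap (p : ℚ[X]) :
    max (algebraMap ℚ[X] (RatFunc ℚ) p).num.natDegree (algebraMap ℚ[X] (RatFunc ℚ) p).denom.natDegree =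
      p.natDegree := by
  rw [RatFunc.num_algebraMap, RatFunc.denom_algebraMap, natDegree_one, Nat.max_eq_left (Nat.zero_le _)]

/-- for a QUOTIENT `P = p/q` (`p, q ≠ 0`): `max (deg num P) (deg denom P) ≤ max (deg p) (deg q)` (the reduced numerator
divides `p`, the reduced denominator divides `q`). -/
theorem degClause_le_of_repr {p q : ℚ[X]} (hp : p ≠ 0) (hq : q ≠ 0) {P : RatFunc ℚ}
    (hP : P = algebraMap ℚ[X] (RatFunc ℚ) p / algebraMap ℚ[X] (RatFunc ℚ) q) :
    max P.num.natDegree P.denom.natDegree ≤ max p.natDegree q.natDegree := by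
  have h1 : P.num ∣ p := (RatFunc.num_dvd hp).mpr ⟨q, hq, hP⟩
  have h2 : P.denom ∣ q := (RatFunc.denom_dvd hq).mpr ⟨p, hP⟩
  exact max_le_max (natDegree_le_of_dvd h1 hp) (natDegree_le_of_dvd h2 hq)

/-! ### §5  Cancelling the common power of an irreducible factor -/

/-- `g ≠ 0` splits off its exact power of an irreducible `u`: `g = u^k · g₀` with `u ∤ g₀`. -/
theorem exists_pow_mul_not_dvd {g u : ℚ[X]} (hg : g ≠ 0) (hu : Irreducible u) :
    ∃ (k : ℕ) (g₀ : ℚ[X]), g = u ^ k * g₀ ∧ ¬ u ∣ g₀ := by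
  obtain ⟨k, g₀, hnd, hg⟩ := WfDvdMonoid.max_power_factor hg hu
  exact ⟨k, g₀, hg, hnd⟩

/-- `g ≠ 0` splits off its exact power of `t`: `g = t^k · g₀` with `g₀(0) ≠ 0`. -/
theorem exists_X_pow_mul_coeff_zero_ne {g : ℚ[X]} (hg : g ≠ 0) :
    ∃ (k : ℕ) (g₀ : ℚ[X]), g = X ^ k * g₀ ∧ g₀.coeff 0 ≠ 0 := by
  obtain ⟨k, g₀, hg, hnd⟩ := exists_pow_mul_not_dvd hg irreducible_X
  exact ⟨k, g₀, hg, fun h => hnd (X_dvd_iff.mpr h)⟩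

/-- re-normalising after cancellation, case `k ≤ m`: `u^k·g₀ / u^m = g₀ / u^(m−k)` in `ℚ(t)`. -/
theorem repr_cancel_le {u g₀ : ℚ[X]} (hu : u ≠ 0) {k m : ℕ} (hkm : k ≤ m) :
    algebraMap ℚ[X] (RatFunc ℚ) (u ^ k * g₀) / algebraMap ℚ[X] (RatFunc ℚ) u ^ m =
      algebraMap ℚ[X] (RatFunc ℚ) g₀ / algebraMap ℚ[X] (RatFunc ℚ) (u ^ (m - k)) := by
  have hu' : algebraMap ℚ[X] (RatFunc ℚ) u ≠ 0 := RatFunc.algebraMap_ne_zero hu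
  obtain ⟨d, rfl⟩ := Nat.exists_eq_add_of_le hkm
  rw [Nat.add_sub_cancel_left, map_mul, map_pow, map_pow, pow_add, mul_div_mul_left _ _ (pow_ne_zero _ hu')]

/-- re-normalising after cancellation, case `m ≤ k`: `u^k·g₀ / u^m = u^(k−m)·g₀`, a POLYNOMIAL. -/
theorem repr_cancel_ge {u g₀ : ℚ[X]} (hu : u ≠ 0) {k m : ℕ} (hmk : m ≤ k) :
    algebraMap ℚ[X] (RatFunc ℚ) (u ^ k * g₀) / algebraMap ℚ[X] (RatFunc ℚ) u ^ m =
      algebraMap ℚ[X] (RatFunc ℚ) (u ^ (k - m) * g₀) := by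
  have hu' : algebraMap ℚ[X] (RatFunc ℚ) u ≠ 0 := RatFunc.algebraMap_ne_zero hu
  obtain ⟨d, rfl⟩ := Nat.exists_eq_add_of_le hmk
  rw [Nat.add_sub_cancel_left, map_mul, map_mul, map_pow, map_pow, pow_add, mul_assoc,
    mul_div_cancel_left₀ _ (pow_ne_zero _ hu')]

/-- a polynomial presentation is a quotient presentation with denominator `1`. -/
theorem repr_algebraMap (p : ℚ[X]) :
    algebraMap ℚ[X] (RatFunc ℚ) p = algebraMap ℚ[X] (RatFunc ℚ) p / algebraMap ℚ[X] (RatFunc ℚ) 1 := by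
  rw [map_one, div_one]

/-! ### §6  The flip `t ↦ 1/t` -/

/-- **THE FLIP.**  If `g₀(t) = x·tᵃ` with `t ≠ 0` and `deg g₀ ≤ a`, then in the parameter `s = 1/t` the value `x` is
POLYNOMIAL: `(reflect a g₀)(s) = x`. -/
theorem eval_reflect_inv_of_eval_eq {g₀ : ℚ[X]} {a : ℕ} (hdeg : g₀.natDegree ≤ a) {t x : ℚ} (ht : t ≠ 0)
    (h : g₀.eval t = x * t ^ a) : (reflect a g₀).eval t⁻¹ = x := by
  haveI : Invertible t := invertibleOfNonzero ht
  have key := eval₂_reflect_mul_pow (RingHom.id ℚ) t a g₀ hdeg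
  rw [eval₂_id, eval₂_id, h, invOf_eq_inv] at key
  exact mul_right_cancel₀ (pow_ne_zero a ht) key

/-- the flipped polynomial has degree `≥ a` when `g₀(0) ≠ 0` (its `a`-th coefficient is `g₀(0)`). -/
theorem le_natDegree_reflect {g₀ : ℚ[X]} {a : ℕ} (h0 : g₀.coeff 0 ≠ 0) : a ≤ (reflect a g₀).natDegree := by
  refine le_natDegree_of_ne_zero ?_
  rwa [coeff_reflect, show revAt a a = 0 by rw [revAt_le le_rfl, Nat.sub_self]]

/-! ### §7  Root facts for the norm shape -/

/-- an IRREDUCIBLE QUADRATIC over `ℚ` has no rational root. -/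
theorem eval_ne_zero_of_irreducible_quadratic {q : ℚ[X]} (hq : Irreducible q) (hq2 : q.natDegree = 2) (t : ℚ) :
    q.eval t ≠ 0 := by
  intro ht
  have h1 := degree_eq_one_of_irreducible_of_root hq ht
  have : q.natDegree = 1 := natDegree_eq_of_degree_eq_some h1
  omega

/-- COPRIME polynomials over `ℚ` have no common complex root. -/
private theorem aeval_ne_zero_of_isCoprime {q g : ℚ[X]} (hc : IsCoprime q g) {z : ℂ} (hz : aeval z q = 0) :
    aeval z g ≠ 0 := by
  intro hg
  obtain ⟨u, v, huv⟩ := hc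
  have := congrArg (aeval z) huv
  rw [map_add, map_mul, map_mul, hz, hg, mul_zero, mul_zero, add_zero, map_one] at this
  exact zero_ne_one this

/-- if `q` is irreducible and does not divide `g₀`, they have no common complex root. -/
theorem aeval_ne_zero_of_irreducible_not_dvd {q g₀ : ℚ[X]} (hq : Irreducible q) (hnd : ¬ q ∣ g₀) {z : ℂ}
    (hz : aeval z q = 0) : aeval z g₀ ≠ 0 :=
  aeval_ne_zero_of_isCoprime ((hq.coprime_iff_not_dvd).mpr hnd) hz

end Summit.Schanuel.Schanuel.Theorems.RootDecomp1KSiegelBridge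

end
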